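import Mathlib.MeasureTheory.Integral.Bochner.Set
import Mathlib.Topology.Algebra.Module.FiniteDimension
import Mathlib.Order.LiminfLimsup
import Literature.Analysis.Convexity.AnisotropicPerimeter
import HarnessLib

/-!
# Lower semicontinuity of the anisotropic perimeter under local convergence of sets

Topic `Literature/Analysis/Convexity`; namespace `Literature.Analysis.Convexity`. Companion of
`AnisotropicPerimeter.lean`
(`anisotropicPerimeter K A = sup {∫_A div φ : φ ∈ C¹_c(V; V), φ(x) ∈ K}`).

"The distributional perimeter is naturally lower semicontinuous with respect to local
convergence" (Maggi 2012, before Proposition 12.15): if `A_i → A` locally, i.e.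
`vol((A_i Δ A) ∩ S) → 0` for every compact `S`, then for EVERY constraint body `K`

  `anisotropicPerimeter K A ≤ liminf_i anisotropicPerimeter K A_i`

(`anisotropicPerimeter_le_liminf_of_tendsto_local`; global form `…_of_tendsto`; De Giorgi's
perimeter `perimeter_le_liminf_of_tendsto_local`). Proof: for a fixed admissible field `φ`,
`div φ` is continuous and compactly supported, hence bounded by `M` and vanishing off a compact `S`,
so `|∫_{A_i} div φ - ∫_A div φ| ≤ M · vol((A_i Δ A) ∩ S) → 0`
(`tendsto_setIntegral_fieldDivergence`); then `∫_A div φ = lim ∫_{A_i} div φ ≤ liminf P_K(A_i)`,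
and the supremum over `φ` concludes. No convexity of `K`, no finiteness of perimeters and no
structure theory are needed for this inequality (Maggi's Theorem 20.1 is the same statement for the
measure-theoretic `Φ(E) = ∫_{∂*E} Φ(ν_E)`, where convexity of `Φ` is what makes it agree with the
distributional supremum).

## References
* F. Maggi, *Sets of Finite Perimeter and Geometric Variational Problems*, CUP 2012:
  (12.6) and Proposition 12.15 (lower semicontinuity of perimeter), p. 125; Theorem 20.1 (20.3),
  p. 258. [`Maggi2012`]
-/

noncomputable section

open Set Filter Function Metric
open _root_.MeasureTheory _root_.MeasureTheory.Measure ContinuousLinearMap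
open scoped ENNReal NNReal Topology symmDiff

namespace Literature.Analysis.Convexity

open Literature.MathematicalPhysics.StatisticalMechanics (fieldDivergence perimeter)

variable {V : Type*} [NormedAddCommGroup V] [InnerProductSpace ℝ V] [FiniteDimensional ℝ V]
  [MeasurableSpace V] [BorelSpace V]

/-! ### The divergence of an admissible field: continuous, compactly supported, bounded -/

omit [MeasurableSpace V] [BorelSpace V] in
/-- `div φ = tr ∘ Dφ` is continuous for `φ ∈ C¹` (any finite-dimensional `V`).
[cite: Maggi2012, (12.6) p. 125 — plumbing] -/
theorem continuous_fieldDivergence {φ : V → V} (hφ : ContDiff ℝ 1 φ) :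
    Continuous (fieldDivergence φ) := by
  set T : (V →L[ℝ] V) →ₗ[ℝ] ℝ :=
    (LinearMap.trace ℝ V).comp (ContinuousLinearMap.coeLM ℝ : (V →L[ℝ] V) →ₗ[ℝ] (V →ₗ[ℝ] V))
    with hT
  have hTc : Continuous T := T.continuous_of_finiteDimensional
  have : fieldDivergence φ = T ∘ fderiv ℝ φ := by
    funext x; simp [hT, fieldDivergence]
  rw [this]
  exact hTc.comp (hφ.continuous_fderiv one_ne_zero)

omit [FiniteDimensional ℝ V] [MeasurableSpace V] [BorelSpace V] in
/-- `div φ` is compactly supported for compactly supported `φ`.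
[cite: Maggi2012, (12.6) p. 125 — plumbing] -/
theorem hasCompactSupport_fieldDivergence' {φ : V → V} (hcφ : HasCompactSupport φ) :
    HasCompactSupport (fieldDivergence φ) := by
  have : fieldDivergence φ =
      (fun A : V →L[ℝ] V => LinearMap.trace ℝ V (A : V →ₗ[ℝ] V)) ∘ fderiv ℝ φ := rfl
  rw [this]
  exact (hcφ.fderiv (𝕜 := ℝ)).comp_left (by simp)

/-! ### Convergence of `∫_{A_i} div φ` under local convergence of the sets -/

/-- **`∫_{A_i} div φ → ∫_A div φ` under local convergence `vol((A_i Δ A) ∩ S) → 0` (all compact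
`S`)**, for `φ ∈ C¹_c`: `|∫_{A_i} div φ - ∫_A div φ| ≤ sup|div φ| · vol((A_i Δ A) ∩ spt div φ)`.
[cite: Maggi2012, Proposition 12.15 p. 125 (proof via (12.6))] -/
theorem tendsto_setIntegral_fieldDivergence {ι : Type*} {l : Filter ι}
    {A : Set V} {As : ι → Set V} (hA : MeasurableSet A) (hAs : ∀ i, MeasurableSet (As i))
    (hloc : ∀ S : Set V, IsCompact S → Tendsto (fun i => volume ((As i ∆ A) ∩ S)) l (𝓝 0))
    {φ : V → V} (hφ : ContDiff ℝ 1 φ) (hcφ : HasCompactSupport φ) :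
    Tendsto (fun i => ∫ x in As i, fieldDivergence φ x) l (𝓝 (∫ x in A, fieldDivergence φ x)) := by
  set f := fieldDivergence φ with hf
  have hfc : Continuous f := continuous_fieldDivergence hφ
  have hfs : HasCompactSupport f := hasCompactSupport_fieldDivergence' hcφ
  have hfi : Integrable f volume := hfc.integrable_of_hasCompactSupport hfs
  obtain ⟨M, hM⟩ : ∃ M, ∀ x, ‖f x‖ ≤ M := hfc.bounded_above_of_compact_support hfs
  have hM0 : 0 ≤ M := (norm_nonneg _).trans (hM 0)
  set S := tsupport f with hS
  have hSc : IsCompact S := hfs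
  have hSm : MeasurableSet S := (isClosed_tsupport f).measurableSet
  -- the error is controlled by `M · vol((A_i Δ A) ∩ S)`
  have hvol := hloc S hSc
  have hfin : ∀ i, volume ((As i ∆ A) ∩ S) < ⊤ := fun i =>
    (measure_mono inter_subset_right).trans_lt hSc.measure_lt_top
  have hbound : ∀ i, ‖(∫ x in As i, f x) - ∫ x in A, f x‖ ≤
      M * (volume ((As i ∆ A) ∩ S)).toReal := by
    intro i
    rw [← integral_indicator (hAs i), ← integral_indicator hA, ← integral_sub
      (hfi.indicator (hAs i)) (hfi.indicator hA)]
    have hptw : ∀ x, ‖(As i).indicator f x - A.indicator f x‖ ≤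
        ((As i ∆ A) ∩ S).indicator (fun _ => M) x := by
      intro x
      have hR : 0 ≤ ((As i ∆ A) ∩ S).indicator (fun _ => M) x :=
        Set.indicator_nonneg (fun _ _ => hM0) _
      -- on the symmetric difference the integrand is `±f x`, bounded by `M` on `S` and `0` off `S`
      have hdiff : x ∈ As i ∆ A → ‖f x‖ ≤ ((As i ∆ A) ∩ S).indicator (fun _ => M) x := by
        intro hx
        by_cases hxS : x ∈ S
        · have hmem : x ∈ (As i ∆ A) ∩ S := ⟨hx, hxS⟩
          rw [Set.indicator_of_mem hmem]; exact hM x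
        · rw [show f x = 0 from image_eq_zero_of_notMem_tsupport hxS, norm_zero]; exact hR
      by_cases h1 : x ∈ As i <;> by_cases h2 : x ∈ A
      · rw [Set.indicator_of_mem h1, Set.indicator_of_mem h2, sub_self, norm_zero]; exact hR
      · rw [Set.indicator_of_mem h1, Set.indicator_of_notMem h2, sub_zero]
        exact hdiff (Set.mem_symmDiff.2 (Or.inl ⟨h1, h2⟩))
      · rw [Set.indicator_of_notMem h1, Set.indicator_of_mem h2, zero_sub, norm_neg]
        exact hdiff (Set.mem_symmDiff.2 (Or.inr ⟨h2, h1⟩))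
      · rw [Set.indicator_of_notMem h1, Set.indicator_of_notMem h2, sub_self, norm_zero]; exact hR
    calc ‖∫ x, ((As i).indicator f x - A.indicator f x)‖
        ≤ ∫ x, ((As i ∆ A) ∩ S).indicator (fun _ => M) x :=
          norm_integral_le_of_norm_le ((integrableOn_const (hfin i).ne).integrable_indicator
            (((hAs i).symmDiff hA).inter hSm)) (Eventually.of_forall hptw)
      _ = M * (volume ((As i ∆ A) ∩ S)).toReal := by
          rw [integral_indicator (((hAs i).symmDiff hA).inter hSm), setIntegral_const, smul_eq_mul,
            mul_comm, measureReal_def]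
  -- `M · vol → 0`
  have hto : Tendsto (fun i => M * (volume ((As i ∆ A) ∩ S)).toReal) l (𝓝 0) := by
    have h1 : Tendsto (fun i => (volume ((As i ∆ A) ∩ S)).toReal) l (𝓝 0) := by
      have := (ENNReal.tendsto_toReal ENNReal.zero_ne_top).comp hvol
      simpa [Function.comp_def] using this
    simpa using h1.const_mul M
  rw [tendsto_iff_norm_sub_tendsto_zero]
  exact squeeze_zero (fun i => norm_nonneg _) hbound hto

/-! ### Lower semicontinuity -/

/-- **Lower semicontinuity of the `K`-perimeter under local convergence:** if
`vol((A_i Δ A) ∩ S) → 0` for every compact `S`, then `P_K(A) ≤ liminf_i P_K(A_i)` — for every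
constraint body `K`. [cite: Maggi2012, Proposition 12.15 p. 125 (with (20.2) p. 258 for a general
integrand; Theorem 20.1 (20.3))] -/
theorem anisotropicPerimeter_le_liminf_of_tendsto_local {ι : Type*} {l : Filter ι} [l.NeBot]
    (K : Set V) {A : Set V} {As : ι → Set V} (hA : MeasurableSet A)
    (hAs : ∀ i, MeasurableSet (As i))
    (hloc : ∀ S : Set V, IsCompact S → Tendsto (fun i => volume ((As i ∆ A) ∩ S)) l (𝓝 0)) :
    anisotropicPerimeter K A ≤ liminf (fun i => anisotropicPerimeter K (As i)) l := by
  refine anisotropicPerimeter_le_iff.2 fun φ h₁ h₂ h₃ => ?_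
  have hconv : Tendsto (fun i => ENNReal.ofReal (∫ x in As i, fieldDivergence φ x)) l
      (𝓝 (ENNReal.ofReal (∫ x in A, fieldDivergence φ x))) :=
    (ENNReal.continuous_ofReal.tendsto _).comp
      (tendsto_setIntegral_fieldDivergence hA hAs hloc h₁ h₂)
  rw [← hconv.liminf_eq]
  exact liminf_le_liminf (Eventually.of_forall fun i => le_anisotropicPerimeter h₁ h₂ h₃)

/-- **Lower semicontinuity of the `K`-perimeter under global `L¹` convergence** `vol(A_i Δ A) → 0`.
[cite: Maggi2012, Proposition 12.15 p. 125 (with (20.2) p. 258)] -/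
theorem anisotropicPerimeter_le_liminf_of_tendsto {ι : Type*} {l : Filter ι} [l.NeBot]
    (K : Set V) {A : Set V} {As : ι → Set V} (hA : MeasurableSet A)
    (hAs : ∀ i, MeasurableSet (As i))
    (h : Tendsto (fun i => volume (As i ∆ A)) l (𝓝 0)) :
    anisotropicPerimeter K A ≤ liminf (fun i => anisotropicPerimeter K (As i)) l :=
  anisotropicPerimeter_le_liminf_of_tendsto_local K hA hAs fun _ _ =>
    tendsto_of_tendsto_of_tendsto_of_le_of_le tendsto_const_nhds h (fun _ => zero_le)
      fun _ => measure_mono inter_subset_left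

/-- **Lower semicontinuity of De Giorgi's perimeter under local convergence.**
[cite: Maggi2012, Proposition 12.15 p. 125] -/
theorem perimeter_le_liminf_of_tendsto_local {ι : Type*} {l : Filter ι} [l.NeBot]
    {A : Set V} {As : ι → Set V} (hA : MeasurableSet A) (hAs : ∀ i, MeasurableSet (As i))
    (hloc : ∀ S : Set V, IsCompact S → Tendsto (fun i => volume ((As i ∆ A) ∩ S)) l (𝓝 0)) :
    perimeter A ≤ liminf (fun i => perimeter (As i)) l := by
  simp only [perimeter_eq_anisotropicPerimeter_closedBall]
  exact anisotropicPerimeter_le_liminf_of_tendsto_local _ hA hAs hloc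

/-- **Lower semicontinuity of De Giorgi's perimeter under `L¹` convergence** `vol(A_i Δ A) → 0`.
[cite: Maggi2012, Proposition 12.15 p. 125] -/
theorem perimeter_le_liminf_of_tendsto {ι : Type*} {l : Filter ι} [l.NeBot]
    {A : Set V} {As : ι → Set V} (hA : MeasurableSet A) (hAs : ∀ i, MeasurableSet (As i))
    (h : Tendsto (fun i => volume (As i ∆ A)) l (𝓝 0)) :
    perimeter A ≤ liminf (fun i => perimeter (As i)) l := by
  simp only [perimeter_eq_anisotropicPerimeter_closedBall]
  exact anisotropicPerimeter_le_liminf_of_tendsto _ hA hAs h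

end Literature.Analysis.Convexity

end
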